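/-
Copyright (c) 2026 the pub-hodgecm-mathlib formalisation cell (harness21).  Prover seat hodgecm-mathlib-B-p14 (g31) (Layer B′ design pen), (F11-c) L8: THE κ = −1 VALUE
`Φ(⟦δ⟧, 1_{K′}) = phiTHprimen q n N` of «N7nsCount» `stub_irredGValueNeg` in the stub frame (architect A-p06 (g26); LEAD F0P3a-plan (g9)), 2026-09-01.
-/
import Literature.NumberTheory.Rogawski1990.UnitOrbitalIntegralInertTypeTwoFrameAnisotropic  -- ★ (this seat): the type-(2) frame at the inert place (with `B₀(x,x) ≠ 0`)
import Literature.NumberTheory.Automorphic.UnitaryThreeAnisotropicNormalFormExponents         -- ★ p842036 (d2): model data ∕ exponents of the normal form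
import Literature.NumberTheory.Automorphic.UnitaryThreeAnisotropicFixedPointSum              -- ★ p842080 (L6): `#Fix = phiTHprimeM` modulo `hβ`
import Literature.NumberTheory.Automorphic.UnitaryThreeAnisotropicFixedPointCountMid          -- ★ (B-p10 (iii-c)): the regime-2 count `hβ`
import Literature.NumberTheory.Automorphic.UnitaryThreeAnisotropicStabilizerCompact          -- ★ p842210 (B-p10 E4″): compact centralisers
import Literature.NumberTheory.Rogawski1990.UnitOrbitalIntegralInertClosedFormsTypeTwoObservable  -- ★ p841969 (B-p12): `phiTHprimen ↔ phiTHprimeM`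
import Literature.NumberTheory.Rogawski1990.FinExplicitTransferFactorInertExponentStub         -- ★ (A-p13): integrality from `hint`, the exponent law
import Literature.NumberTheory.Automorphic.UnitaryGroupIntegralPointsReductionInert            -- ★ frame data at an inert place (`σ_w` on `𝒪_w`, `#𝓀_w = q_v²`)
import Literature.NumberTheory.LocalFields.UnramifiedQuadraticNormAtInertPlace                -- ★ `exists_isUnit_map_sub_of_residueHom_ne`
import Literature.LinearAlgebra.Matrix.FiniteFieldHermitianAnisotropic                       -- ★ `exists_frob_ne`
import Literature.NumberTheory.Automorphic.LocalUnitaryGroupCongr                             -- ★ `antidiagOne_eq_over`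
import Literature.NumberTheory.Automorphic.HyperspecialUnitaryCartanAdicCompletion            -- ★ `exists_sq_eq_of_valued_sub_one_lt`
import Literature.NumberTheory.Automorphic.AdicCompletionCompact                             -- ★ `compactSpace_integer_adicCompletion`
import Literature.NumberTheory.Automorphic.AdicCompletionIntegersAdicComplete                  -- ★ p842102 (F0P3b-p01, (o-AC)): `isAdicComplete_maximalIdeal_valuedInteger_adicCompletion` (ED. 2)
import HarnessLib

/-!
# The κ = −1 value of the inert unit fundamental lemma, type (2): `Φ(⟦δ⟧, 1_{K′}) = Φ′(t″) = phiTHprimen q_v n N` (Flicker 1998, Prop. 17 p. 97; Thm. 18)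

Topic `NumberTheory/Rogawski1990`; namespace `Literature.NumberTheory.Rogawski1990`.  THEOREMS ONLY (no `def`, no instance, no notation, no named fact, no `sorry`).
Cell `pub/hodgecm-mathlib`, crux H413 = `stmt-HodgeConjecture-24833`, line «N7nsCount» ED. 1.5: this file is the CLOSER of the value stub `stub_irredGValueNeg` (:1269,
κ = −1) — its head is a SUB-LIST of the stub's binders (frame `hH′ w hw hv hH′w hH′i`, the `G′_v`-measure data `νG mG hmG hνG`, `hH′u`, `hreg`, `h2`, `hint`, `hirr`-free,
the observable exponents `n N hn hN`) plus ONE carried instance binder `[IsAdicComplete 𝓂[𝒪_w] 𝒪_w]` ((o-AC), p06 (g11)), and its conclusion is the stub's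
`∀ δ, IsLocalNormPair γ_H δ → κ_v(γ_H, δ) = −1 → Φ(⟦δ⟧, 1_{K′}) = phiTHprimen q_v n N` — so the stub is `:= closer …` once (o-AC) lands.
THE CHAIN (all ★): frame ★ `exists_typeTwo_frame` (`t = e δ ∈ U_w`, eigenvector `x`, `tr∕det`, κ-parity, socket) → κ = −1 ⇒ `ord_w B₀(x,x)` odd → ★ (d1)
`exists_smul_one_inv_mul_conj_mem_stabilizer` (`t′ = z⁻¹(g⁻¹tg) ∈ Stab(w₀)`) → ★ (C′) coordinates → ★ (d2) `model_trace_det_of_normalForm` ∕ `v_model_invariants_eq` + ★ Bounds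
ED. 2 (`|q_t| = |ϖ|^N`, `|A_t − s_t| ≤ |ϖ|^{N+1}`) + the `M`-datum (★ A-p13 exponent law `n = min(2N+1, 2M)`) → ★ (E4″) compactness → `Φ = #Fix(t) = #Fix(t′)` (★ (d2)) →
★ L6 `natCard_fixedPoints_unitaryInt_eq_phiTHprimeM` with `hβ :=` ★ B-p10 (iii-c) → ★ `phiTHprimen_eq_phiTHprimeM_of_eq_min`.
HONEST LABEL: HC_CM is proved only modulo the printed citations until rung 0 closes; this discharges ONE of the six value stubs of #103-ns modulo (o-AC).

## References
* [Flicker1998UnitaryFL] Y. Z. Flicker, *Elementary proof of the fundamental lemma for a unitary group*, Canad. J. Math. 50 (1998), Prop. 5 p. 82, Prop. 16 p. 96, Prop. 17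
  p. 97, Thm. 18 p. 97.
* [Rogawski1990] J. D. Rogawski, *Automorphic Representations of Unitary Groups in Three Variables* (1990), §4.9 Prop. 4.9.1 (b) p. 55, §14.2 p. 233.
-/

set_option autoImplicit false

noncomputable section

open MeasureTheory Measure NumberField IsDedekindDomain Matrix Polynomial
open scoped MatrixGroups

namespace Literature.NumberTheory.Rogawski1990

open Literature.NumberTheory.Automorphic Literature.NumberTheory.Automorphic.UnitaryGroup
open Literature.NumberTheory.Automorphic.IntegralReduction Literature.NumberTheory.GaloisRepresentations
open Literature.NumberTheory.Automorphic.HermitianLattice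

variable (L : Type) [Field L] [NumberField L] [IsCMField L] (H' : Matrix (Fin 3) (Fin 3) L) {v : HeightOneSpectrum (𝓞 ↥(maximalRealSubfield L))}

set_option synthInstance.maxHeartbeats 200000 in  -- the coset action `U_w ↷ U_w ⧸ unitaryInt` (as in ★ `FixedCosetsTransport`)

open scoped Classical in
/-- **THE κ = −1 VALUE (closer of `stub_irredGValueNeg`).**  At a finite place `v` of `L⁺` non-split and unramified in `L`, of good reduction for the hermitian invertible
`H′`, with `m_G` canonical for `(IsRegularElt, ν_G)` and `ν_G(K′) = 1`, `2 ∈ 𝒪_w^×`, `𝒪_w` adically complete: for a `G`-regular `γ_H = (g, u)` with `χ_{ι(γ_H),w}` integral,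
`|χ_g(u)|_w = q^{−n}` and `|tr g_w² − 4 det g_w|_w = q^{−(2N+1)}` (type (2): odd order), EVERY matched `δ ∈ G′_v` with `κ_v(γ_H, δ) = −1` has
**`Φ(⟦δ⟧, 1_{K′}) = phiTHprimen q_v n N`** — Flicker's `Φ′(t″)` (Prop. 17), i.e. `Σ_m` of Prop. 16's counts over the anisotropic double cosets.
[cite: Flicker1998UnitaryFL, Prop. 17 p. 97; Prop. 16 p. 96; Thm. 18 p. 97] [cite: Rogawski1990, §4.9 Prop. 4.9.1 (b) p. 55] -/
theorem classOrbitalIntegral_indicator_eq_phiTHprimen_of_finKappaAt_eq_neg_one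
    (hH' : (H'.map (IsCMField.complexConj L))ᵀ = H') (hH'u : IsUnit H')
    (w : PlacesOver L v) (hw : IsCMField.complexConj L • w.1 = w.1) (hv : Algebra.IsUnramifiedIn (𝓞 L) v.asIdeal)
    (hH'w : IsUnit (placeForm H' w.1)) (hH'i : hH'w.unit ∈ glInt 3 (w.1.adicCompletion L))
    [MeasurableSpace ((cmDatum L 3 H').Local v)] [BorelSpace ((cmDatum L 3 H').Local v)]
    [∀ γ : ((cmDatum L 3 H').Local v), MeasurableSpace (((cmDatum L 3 H').Local v) ⧸ Subgroup.centralizer ({γ} : Set ((cmDatum L 3 H').Local v)))]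
    [∀ γ : ((cmDatum L 3 H').Local v), BorelSpace (((cmDatum L 3 H').Local v) ⧸ Subgroup.centralizer ({γ} : Set ((cmDatum L 3 H').Local v)))]
    (νG : Measure ((cmDatum L 3 H').Local v)) [νG.IsHaarMeasure] [νG.IsMulRightInvariant]
    {mG : OrbitalMeasureFamily ((cmDatum L 3 H').Local v)}
    (hmG : mG.IsCanonical (fun γ => IsRegularElt (γ.val : GL (Fin 3) (UnitaryGroup.LocalRing L v))) νG)
    (hνG : νG (cmLocalIntegralLevel L 3 H' v : Set ((cmDatum L 3 H').Local v)) = 1)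
    [IsAdicComplete (IsLocalRing.maximalIdeal (Valued.integer (w.1.adicCompletion L))) (Valued.integer (w.1.adicCompletion L))]
    (h2 : IsUnit (2 : (ValuativeRel.valuation (w.1.adicCompletion L)).integer))
    {γH : (cmDatum L 2 (Matrix.of fun i j : Fin 2 => if i.val + j.val + 1 = 2 then (1 : L) else 0)).Local v ×
      (cmDatum L 1 (Matrix.of fun i j : Fin 1 => if i.val + j.val + 1 = 1 then (1 : L) else 0)).Local v}
    (hreg : IsLocalGRegular L v γH)
    (hint : ∀ i : ℕ, ((((endoEmbLocal L v γH).val : GL (Fin 3) (LocalRing L v)).val.map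
        (Pi.evalRingHom (fun w' : PlacesOver L v => w'.1.adicCompletion L) w)).charpoly.coeff i) ∈ (ValuativeRel.valuation (w.1.adicCompletion L)).integer)
    (n N : ℕ)
    (hn : Valued.v (((finCharpolyTwo L v γH).eval (finGammaTwo L v γH)) w) = WithZero.exp (-(n : ℤ)))
    (hN : Valued.v (((γH.1.val : GL (Fin 2) (LocalRing L v)).val.map
        (Pi.evalRingHom (fun w' : PlacesOver L v => w'.1.adicCompletion L) w)).trace ^ 2 -
      4 * ((γH.1.val : GL (Fin 2) (LocalRing L v)).val.map
        (Pi.evalRingHom (fun w' : PlacesOver L v => w'.1.adicCompletion L) w)).det) = WithZero.exp (-((2 * N + 1 : ℕ) : ℤ)))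
    (δ : (cmDatum L 3 H').Local v) (h : IsLocalNormPair L H' v γH δ) (hκ : finKappaAt L v H' γH δ = -1) :
    classOrbitalIntegral mG ((cmLocalIntegralLevel L 3 H' v : Set ((cmDatum L 3 H').Local v)).indicator fun _ => (1 : ℂ)) (ConjClasses.mk δ) =
      ((Flicker1998.phiTHprimen (Ideal.absNorm v.asIdeal) n N : ℚ) : ℂ) := by
  have hc1 : IsCMField.complexConj L ≠ 1 := IsCMField.complexConj_ne_one L
  have hsub : Subsingleton (PlacesOver L v) := PlacesOver.subsingleton_of_smul_eq (IsCMField.complexConj L) hc1 w hw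
  -- §0 the frame data at `w`: `K = L_w`, `σ = σ_w`, `ϖ = ι_w(ϖ_v)`, `J = Φ₃`
  have hJ : placeForm (Matrix.of fun i j : Fin 3 => if i.val + j.val + 1 = 3 then (1 : L) else 0) w.1 =
      (StdForm.antidiagonal 3).over (w.1.adicCompletion L) := by
    rw [placeForm, antidiagOne_eq_over, StdForm.over_map]
  -- the stub's `ValuativeRel` integer ring vs the `Valued.integer` currency of the U-level files: equivalent valuations, the same subring of `L_w`
  have hiso := ValuativeRel.isEquiv (ValuativeRel.valuation (w.1.adicCompletion L)) (Valued.v : Valuation (w.1.adicCompletion L) (WithZero (Multiplicative ℤ)))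
  have hintV : ∀ i : ℕ, ((((endoEmbLocal L v γH).val : GL (Fin 3) (UnitaryGroup.LocalRing L v)).val.map
      (Pi.evalRingHom (fun w' : PlacesOver L v => w'.1.adicCompletion L) w)).charpoly.coeff i) ∈ Valued.integer (w.1.adicCompletion L) :=
    fun i => (Valuation.mem_integer_iff _ _).2 ((hiso.le_one_iff_le_one).1 ((Valuation.mem_integer_iff _ _).1 (hint i)))
  have h2w : Valued.v (2 : w.1.adicCompletion L) = 1 := by
    have h := (Valuation.Integers.isUnit_iff_valuation_eq_one (Valuation.integer.integers _)).1 h2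
    rw [map_ofNat] at h
    exact (hiso.eq_one_iff_eq_one).1 h
  have hϖv := Liu2021.LemD1IndexedNonVacuityInertCofinite.valued_toPlace_uniformizer_of_isUnramifiedIn L v hv w
  have hd : LocalConjDatum (galAdicCompletionMap (L := L) (IsCMField.complexConj L) hw)
      (toPlace v w (HeckeCharacter.uniformizer ↥(maximalRealSubfield L) v : v.adicCompletion ↥(maximalRealSubfield L))) :=
    { σσ := fun x => galAdicCompletionMap_complexConj_self L v w hw x
      vσ := fun x => valued_galAdicCompletionMap (L := L) (IsCMField.complexConj L) hw x
      σϖ := galAdicCompletionMap_toPlace (IsCMField.complexConj L) w w hw _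
      vϖ := hϖv
      v2 := h2w
      sqrt := exists_sq_eq_of_valued_sub_one_lt w.1 h2w }
  haveI : CompactSpace (Valued.integer (w.1.adicCompletion L)) := compactSpace_integer_adicCompletion L w.1
  have hO : (ValuativeRel.valuation (w.1.adicCompletion L)).integer = Valued.integer (w.1.adicCompletion L) := by
    rw [integer_valuation_eq_adicCompletionIntegers]
    ext x
    simp only [ValuationSubring.mem_toSubring, HeightOneSpectrum.mem_adicCompletionIntegers, Valued.integer, Valuation.mem_integer_iff]
  have hmem : ∀ x : w.1.adicCompletion L, x ∈ (ValuativeRel.valuation (w.1.adicCompletion L)).integer ↔ x ∈ Valued.integer (w.1.adicCompletion L) :=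
    fun x => by rw [hO]
  let eO : ↥(ValuativeRel.valuation (w.1.adicCompletion L)).integer ≃+* ↥(Valued.integer (w.1.adicCompletion L)) := RingEquiv.subringCongr hO
  have hσO' : ∀ x : ↥(ValuativeRel.valuation (w.1.adicCompletion L)).integer,
      galAdicCompletionMap (L := L) (IsCMField.complexConj L) hw x ∈ (ValuativeRel.valuation (w.1.adicCompletion L)).integer :=
    mem_integer_galAdicCompletionMap (IsCMField.complexConj L) v w hw
  have hσO : ∀ y : Valued.integer (w.1.adicCompletion L), ((galAdicCompletionMap (L := L) (IsCMField.complexConj L) hw).comp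
      (Valued.integer (w.1.adicCompletion L)).subtype) y ∈ Valued.integer (w.1.adicCompletion L) :=
    fun y => (hmem _).1 (hσO' ⟨y, (hmem _).2 y.2⟩)
  let σR : ↥(ValuativeRel.valuation (w.1.adicCompletion L)).integer →+* ↥(ValuativeRel.valuation (w.1.adicCompletion L)).integer :=
    ((galAdicCompletionMap (L := L) (IsCMField.complexConj L) hw).comp (ValuativeRel.valuation (w.1.adicCompletion L)).integer.subtype).codRestrict
      (ValuativeRel.valuation (w.1.adicCompletion L)).integer fun x => hσO' x
  have hqR := natCard_residueField_eq_sq_of_inert (IsCMField.complexConj L) v hc1 hv w hw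
  have hq : Nat.card (IsLocalRing.ResidueField (Valued.integer (w.1.adicCompletion L))) = Nat.card (𝓞 ↥(maximalRealSubfield L) ⧸ v.asIdeal) ^ 2 := by
    rw [← Nat.card_congr (IsLocalRing.ResidueField.mapEquiv eO).toEquiv, hqR]
  obtain ⟨σk, hσk⟩ := exists_residueField_ringHom_galAdicCompletionMap (IsCMField.complexConj L) v w hw
  letI : Fintype (IsLocalRing.ResidueField ↥(ValuativeRel.valuation (w.1.adicCompletion L)).integer) := Fintype.ofFinite _
  have hq' : Fintype.card (IsLocalRing.ResidueField ↥(ValuativeRel.valuation (w.1.adicCompletion L)).integer) =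
      Nat.card (𝓞 ↥(maximalRealSubfield L) ⧸ v.asIdeal) ^ 2 := by
    rw [← Nat.card_eq_fintype_card, hqR]
  obtain ⟨a₀, ha₀⟩ := LocalFields.UnramifiedQuadraticNorm.exists_isUnit_map_sub_of_residueHom_ne
    (galAdicCompletionMap (L := L) (IsCMField.complexConj L) hw) (fun x => hσO' x) σk hσk
    (Literature.LinearAlgebra.Matrix.exists_frob_ne hq' σk
      (residueHom_galAdicCompletionMap_eq_pow (IsCMField.complexConj L) v hc1 hv w hw σk (fun x => hσO' x) hσk))
  have ha₀' : IsUnit ((((galAdicCompletionMap (L := L) (IsCMField.complexConj L) hw).comp (Valued.integer (w.1.adicCompletion L)).subtype).codRestrict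
      (Valued.integer (w.1.adicCompletion L)) hσO) (eO a₀) - eO a₀) := by
    have h := (ha₀ : IsUnit (σR a₀ - a₀)).map eO
    rw [map_sub] at h
    convert h using 2
    exact Subtype.ext rfl
  have hq1 : 1 < Nat.card (𝓞 ↥(maximalRealSubfield L) ⧸ v.asIdeal) := by
    haveI : Finite (𝓞 ↥(maximalRealSubfield L) ⧸ v.asIdeal) := Ideal.finiteQuotientOfFreeOfNeBot v.asIdeal v.ne_bot
    haveI : Nontrivial (𝓞 ↥(maximalRealSubfield L) ⧸ v.asIdeal) := Ideal.Quotient.nontrivial_iff.2 v.isPrime.ne_top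
    exact Finite.one_lt_card
  haveI : Finite (IsLocalRing.ResidueField (Valued.integer (w.1.adicCompletion L))) :=
    Nat.finite_of_card_ne_zero (by rw [hq]; exact pow_ne_zero 2 (by omega))
  have hqabs : Ideal.absNorm v.asIdeal = Nat.card (𝓞 ↥(maximalRealSubfield L) ⧸ v.asIdeal) := by
    rw [Ideal.absNorm_apply, Submodule.cardQuot_apply]
  -- `χ_g(u)` is a unit (its `w`-component has valuation `q^{−n} ≠ 0`, one place)
  have hu : IsUnit ((finCharpolyTwo L v γH).eval (finGammaTwo L v γH)) := by
    refine isUnit_localRing_of_ne_zero_of_subsingleton L v hsub fun h0 => ?_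
    have h1 := hn
    rw [h0, Pi.zero_apply, map_zero] at h1
    exact WithZero.coe_ne_zero h1.symm
  -- §1 the frame: `t = e δ ∈ U_w`, eigenvector `x`, trace∕det, κ-parity, compactness transport, socket
  obtain ⟨T, t, x, -, -, -, hx, -, hB0, htr, hdet, hkp, -, hcomp, hΦ⟩ :=
    exists_typeTwo_frame_anisotropic L H' hH' hH'u w hw hv hH'w hH'i νG hmG hνG hreg hu δ h
  -- §2 κ = −1 ⇒ `v_w(B₀(x,x)) = exp(2k+1)`
  have hvB : Valued.v (B₀ (galAdicCompletionMap (L := L) (IsCMField.complexConj L) hw) 3 x x) ≠ 0 := (Valuation.ne_zero_iff _).2 hB0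
  obtain ⟨m, hm⟩ : ∃ m : ℤ, Valued.v (B₀ (galAdicCompletionMap (L := L) (IsCMField.complexConj L) hw) 3 x x) = WithZero.exp m :=
    ⟨_, (WithZero.exp_log hvB).symm⟩
  obtain ⟨k, hk⟩ : ∃ k : ℤ, m = 2 * k + 1 := by
    rcases Int.even_or_odd m with ⟨k, hk⟩ | ⟨k, hk⟩
    · exfalso
      have h1 := hkp k (by rw [hm, hk, two_mul])
      rw [hκ] at h1
      norm_num at h1
    · exact ⟨k, hk⟩
  have hodd : Valued.v (B₀ (galAdicCompletionMap (L := L) (IsCMField.complexConj L) hw) 3 x x) = WithZero.exp (2 * k + 1) := by rw [hm, hk]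
  -- §3 the κ = −1 normal form `t′ = z⁻¹ (g⁻¹ t g) ∈ Stab(w₀)` and its (C′) coordinates
  obtain ⟨g, z, hz, hzK, hzc, -, ht'S⟩ :=
    exists_smul_one_inv_mul_conj_mem_stabilizer (galAdicCompletionMap (L := L) (IsCMField.complexConj L) hw) hJ hd hσO ha₀' hx hodd
  obtain ⟨bt, qt, rt, st, ht'c⟩ := exists_coe_eq_of_mulVec_anisoVec_eq (galAdicCompletionMap (L := L) (IsCMField.complexConj L) hw) hJ hd
    ((mem_stabilizer_anisoVec_iff (galAdicCompletionMap (L := L) (IsCMField.complexConj L) hw) _ _).1 ht'S)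
  -- §4 model data: `A + s = tr g_w ∕ u`, `As − 4ϖqr = det g_w ∕ u²`; valuations of disc, `tr − 2u`, `χ_g(u)`
  have hu1 : galAdicCompletionMap (L := L) (IsCMField.complexConj L) hw (finGammaTwo L v γH w) * finGammaTwo L v γH w = 1 :=
    map_mul_self_eq_one_of_mulVec_eq_smul (galAdicCompletionMap (L := L) (IsCMField.complexConj L) hw) hJ t hx hB0
  have hu0 : finGammaTwo L v γH w ≠ 0 := fun h0 => by rw [h0, mul_zero] at hu1; exact zero_ne_one hu1
  obtain ⟨hAs, hdet2⟩ := model_trace_det_of_normalForm (galAdicCompletionMap (L := L) (IsCMField.complexConj L) hw) hu0 hz htr hdet ht'c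
  obtain ⟨hvdisc, hvtr, hveval⟩ := v_model_invariants_eq (galAdicCompletionMap (L := L) (IsCMField.complexConj L) hw) hJ hd ht'c hu1 hAs hdet2
  -- §5 the type-(2) sizes `|q_t| = |ϖ|^N`, `|A_t − s_t| ≤ |ϖ|^{N+1}` from the odd discriminant
  obtain ⟨hst1, -, hAt1, -⟩ := stabilizer_valuation_bounds (galAdicCompletionMap (L := L) (IsCMField.complexConj L) hw) hJ hd ht'c
  have hD : Valued.v (((1 + 4 * toPlace v w (HeckeCharacter.uniformizer ↥(maximalRealSubfield L) v : v.adicCompletion ↥(maximalRealSubfield L)) * bt) - st) ^ 2 -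
      16 * toPlace v w (HeckeCharacter.uniformizer ↥(maximalRealSubfield L) v : v.adicCompletion ↥(maximalRealSubfield L)) *
        (1 + 4 * toPlace v w (HeckeCharacter.uniformizer ↥(maximalRealSubfield L) v : v.adicCompletion ↥(maximalRealSubfield L)) * bt) *
        (galAdicCompletionMap (L := L) (IsCMField.complexConj L) hw qt * qt) / galAdicCompletionMap (L := L) (IsCMField.complexConj L) hw st) =
      WithZero.exp (-((2 * N + 1 : ℕ) : ℤ)) := by rw [hvdisc]; exact hN
  obtain ⟨hqt, hAst⟩ := v_q_eq_and_v_sub_le_of_v_disc (galAdicCompletionMap (L := L) (IsCMField.complexConj L) hw) hd hAt1 hst1 N hD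
  have hrt : Valued.v rt = WithZero.exp (-(N : ℤ)) := by
    rw [stabilizer_v_r_eq_v_q (galAdicCompletionMap (L := L) (IsCMField.complexConj L) hw) hJ hd ht'c, hqt]
  -- §6 the `M`-datum and the exponent law `n = min(2N+1, 2M)`
  obtain ⟨htrle, -⟩ := valued_trace_le_one_and_valued_det_le_one_of_hint L v w hw γH hintV
  have hule : Valued.v (finGammaTwo L v γH w) ≤ 1 := (valued_finGammaTwo_apply_eq_one L v γH w hw).le
  have heval := eval_finCharpolyTwo_finGammaTwo_apply_eq_quadratic L v w γH
  obtain ⟨M, hMle, hMgt, hlaw⟩ : ∃ M : ℕ,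
      (M ≤ N → Valued.v ((1 + 4 * toPlace v w (HeckeCharacter.uniformizer ↥(maximalRealSubfield L) v : v.adicCompletion ↥(maximalRealSubfield L)) * bt) - 1) =
        WithZero.exp (-(M : ℤ))) ∧
      (N < M → Valued.v ((1 + 4 * toPlace v w (HeckeCharacter.uniformizer ↥(maximalRealSubfield L) v : v.adicCompletion ↥(maximalRealSubfield L)) * bt) - 1) ≤
        WithZero.exp (-((N : ℤ) + 1))) ∧
      n = min (2 * N + 1) (2 * M) := by
    by_cases htb : ((γH.1.val : GL (Fin 2) (LocalRing L v)).val.map (Pi.evalRingHom (fun w' : PlacesOver L v => w'.1.adicCompletion L) w)).trace =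
        2 * finGammaTwo L v γH w
    · refine ⟨N + 1, fun hMN => absurd hMN (by omega), fun _ => ?_, ?_⟩
      · refine v_sub_one_le_of_le (galAdicCompletionMap (L := L) (IsCMField.complexConj L) hw) hd hAst ?_
        rw [hvtr, htb, sub_self, map_zero]; exact zero_le
      · have h1 := valued_quadratic_eval_eq_exp_neg_of_eq L v w h2w hN htb
        rw [← heval, hn] at h1
        have h2 := WithZero.exp_injective h1
        rw [min_eq_left (by omega)]; omega
    · have hne : ((γH.1.val : GL (Fin 2) (LocalRing L v)).val.map (Pi.evalRingHom (fun w' : PlacesOver L v => w'.1.adicCompletion L) w)).trace -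
          2 * finGammaTwo L v γH w ≠ 0 := sub_ne_zero.2 htb
      have hle : Valued.v (((γH.1.val : GL (Fin 2) (LocalRing L v)).val.map (Pi.evalRingHom (fun w' : PlacesOver L v => w'.1.adicCompletion L) w)).trace -
          2 * finGammaTwo L v γH w) ≤ 1 := by
        refine (Valuation.map_sub _ _ _).trans (max_le htrle ?_)
        rw [map_mul, h2w, one_mul]; exact hule
      obtain ⟨M, hM⟩ := exists_nat_valued_eq_exp_neg L v w hne hle
      refine ⟨M, fun hMN => ?_, fun hNM => ?_, ?_⟩
      · rw [← hM, ← hvtr]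
        refine v_sub_one_eq_of_lt (galAdicCompletionMap (L := L) (IsCMField.complexConj L) hw) hd hAst ?_
        rw [hvtr, hM, WithZero.exp_lt_exp]; omega
      · refine v_sub_one_le_of_le (galAdicCompletionMap (L := L) (IsCMField.complexConj L) hw) hd hAst ?_
        rw [hvtr, hM, WithZero.exp_le_exp]; omega
      · have h1 := valued_quadratic_eval_eq_exp_neg_min L v w h2w hN hM
        rw [← heval, hn] at h1
        have h2 := WithZero.exp_injective h1
        omega
  -- §7 compactness: `Z(t′)` compact ⇒ `Z(g⁻¹tg) = Z(z t′)` compact ⇒ `Z(t)` ⇒ `Z(δ)`; then the socket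
  have hZt' := compactSpace_centralizer_of_mem_stabilizer_of_typeTwo (galAdicCompletionMap (L := L) (IsCMField.complexConj L) hw) hJ hd ht'c N hqt hrt hAst
  have hZ1 : CompactSpace ↥(Subgroup.centralizer ({g⁻¹ * t * g} : Set ↥(unitaryGroupOfForm (galAdicCompletionMap (L := L) (IsCMField.complexConj L) hw)
      (placeForm (Matrix.of fun i j : Fin 3 => if i.val + j.val + 1 = 3 then (1 : L) else 0) w.1)))) := by
    rw [show g⁻¹ * t * g = z * (z⁻¹ * (g⁻¹ * t * g)) by group, centralizer_singleton_mul_eq_of_forall_commute hzc]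
    exact hZt'
  have hZt : CompactSpace ↥(Subgroup.centralizer ({t} : Set ↥(unitaryGroupOfForm (galAdicCompletionMap (L := L) (IsCMField.complexConj L) hw)
      (placeForm (Matrix.of fun i j : Fin 3 => if i.val + j.val + 1 = 3 then (1 : L) else 0) w.1)))) := by
    have h1 := (compactSpace_centralizer_conj_iff g⁻¹ t).1
    rw [inv_inv] at h1
    exact h1 hZ1
  have hΦ' := hΦ (hcomp hZt)
  -- §8 the count: `#Fix(t) = #Fix(t′) = phiTHprimeM q M N = phiTHprimen q n N`
  have hd3 : ∀ m : ℕ, ∃ d : ↥(unitaryGroupOfForm (galAdicCompletionMap (L := L) (IsCMField.complexConj L) hw)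
      (placeForm (Matrix.of fun i j : Fin 3 => if i.val + j.val + 1 = 3 then (1 : L) else 0) w.1)),
      ((d : GL (Fin 3) (w.1.adicCompletion L)) : Matrix (Fin 3) (Fin 3) (w.1.adicCompletion L)) =
        !![toPlace v w (HeckeCharacter.uniformizer ↥(maximalRealSubfield L) v : v.adicCompletion ↥(maximalRealSubfield L)) ^ m, 0, 0; 0, 1, 0;
          0, 0, (toPlace v w (HeckeCharacter.uniformizer ↥(maximalRealSubfield L) v : v.adicCompletion ↥(maximalRealSubfield L)) ^ m)⁻¹] :=
    fun m => exists_coe_eq_flickerDiag (galAdicCompletionMap (L := L) (IsCMField.complexConj L) hw) hJ hd m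
  choose d hdm using hd3
  have hcount := natCard_fixedPoints_unitaryInt_eq_phiTHprimeM (galAdicCompletionMap (L := L) (IsCMField.complexConj L) hw) hJ hd hσO ha₀' hq hq1 d hdm
    ht'S ht'c N M hqt hAst hMle hMgt
    (fun m h1 h2 h3 => natCard_fixedPoints_quotient_of_le_of_le (galAdicCompletionMap (L := L) (IsCMField.complexConj L) hw) hJ hd hσO ha₀' hq d m (hdm m)
      ht'S ht'c N h1.le h2 hqt hrt hAst (hMgt h3))
  have hfix := (natCard_fixedPoints_quotient_normalForm_eq (galAdicCompletionMap (L := L) (IsCMField.complexConj L) hw)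
    (unitaryInt (galAdicCompletionMap (L := L) (IsCMField.complexConj L) hw)
      (placeForm (Matrix.of fun i j : Fin 3 => if i.val + j.val + 1 = 3 then (1 : L) else 0) w.1)) hzK hzc g t).1
  rw [hΦ', ← hfix, hqabs, Flicker1998.phiTHprimen_eq_phiTHprimeM_of_eq_min hlaw, ← hcount, Rat.cast_natCast]

/-! ## ED. 2 (append-only): the carried instance `[IsAdicComplete 𝓂[𝒪_w] 𝒪_w]` DISCHARGED by ★ (o-AC) `isAdicComplete_maximalIdeal_valuedInteger_adicCompletion` -/

set_option synthInstance.maxHeartbeats 200000 in  -- as above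
open scoped Classical in
/-- **THE κ = −1 VALUE, BINDER-FREE (ED. 2)** — ★ `classOrbitalIntegral_indicator_eq_phiTHprimen_of_finKappaAt_eq_neg_one` with its one carried instance
`[IsAdicComplete 𝓂[𝒪_w] 𝒪_w]` supplied by ★ `isAdicComplete_maximalIdeal_valuedInteger_adicCompletion` (F0P3b-p01, (o-AC)): every hypothesis is now one of the stub's
own binders, so `stub_irredGValueNeg := fun δ h hκ => …'` closes :1274 by name. [cite: Flicker1998UnitaryFL, Prop. 17 p. 97; Thm. 18 p. 97]
[cite: Rogawski1990, §4.9 Prop. 4.9.1 (b) p. 55] -/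
theorem classOrbitalIntegral_indicator_eq_phiTHprimen_of_finKappaAt_eq_neg_one'
    (hH' : (H'.map (IsCMField.complexConj L))ᵀ = H') (hH'u : IsUnit H')
    (w : PlacesOver L v) (hw : IsCMField.complexConj L • w.1 = w.1) (hv : Algebra.IsUnramifiedIn (𝓞 L) v.asIdeal)
    (hH'w : IsUnit (placeForm H' w.1)) (hH'i : hH'w.unit ∈ glInt 3 (w.1.adicCompletion L))
    [MeasurableSpace ((cmDatum L 3 H').Local v)] [BorelSpace ((cmDatum L 3 H').Local v)]
    [∀ γ : ((cmDatum L 3 H').Local v), MeasurableSpace (((cmDatum L 3 H').Local v) ⧸ Subgroup.centralizer ({γ} : Set ((cmDatum L 3 H').Local v)))]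
    [∀ γ : ((cmDatum L 3 H').Local v), BorelSpace (((cmDatum L 3 H').Local v) ⧸ Subgroup.centralizer ({γ} : Set ((cmDatum L 3 H').Local v)))]
    (νG : Measure ((cmDatum L 3 H').Local v)) [νG.IsHaarMeasure] [νG.IsMulRightInvariant]
    {mG : OrbitalMeasureFamily ((cmDatum L 3 H').Local v)}
    (hmG : mG.IsCanonical (fun γ => IsRegularElt (γ.val : GL (Fin 3) (UnitaryGroup.LocalRing L v))) νG)
    (hνG : νG (cmLocalIntegralLevel L 3 H' v : Set ((cmDatum L 3 H').Local v)) = 1)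
    (h2 : IsUnit (2 : (ValuativeRel.valuation (w.1.adicCompletion L)).integer))
    {γH : (cmDatum L 2 (Matrix.of fun i j : Fin 2 => if i.val + j.val + 1 = 2 then (1 : L) else 0)).Local v ×
      (cmDatum L 1 (Matrix.of fun i j : Fin 1 => if i.val + j.val + 1 = 1 then (1 : L) else 0)).Local v}
    (hreg : IsLocalGRegular L v γH)
    (hint : ∀ i : ℕ, ((((endoEmbLocal L v γH).val : GL (Fin 3) (LocalRing L v)).val.map
        (Pi.evalRingHom (fun w' : PlacesOver L v => w'.1.adicCompletion L) w)).charpoly.coeff i) ∈ (ValuativeRel.valuation (w.1.adicCompletion L)).integer)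
    (n N : ℕ)
    (hn : Valued.v (((finCharpolyTwo L v γH).eval (finGammaTwo L v γH)) w) = WithZero.exp (-(n : ℤ)))
    (hN : Valued.v (((γH.1.val : GL (Fin 2) (LocalRing L v)).val.map
        (Pi.evalRingHom (fun w' : PlacesOver L v => w'.1.adicCompletion L) w)).trace ^ 2 -
      4 * ((γH.1.val : GL (Fin 2) (LocalRing L v)).val.map
        (Pi.evalRingHom (fun w' : PlacesOver L v => w'.1.adicCompletion L) w)).det) = WithZero.exp (-((2 * N + 1 : ℕ) : ℤ)))
    (δ : (cmDatum L 3 H').Local v) (h : IsLocalNormPair L H' v γH δ) (hκ : finKappaAt L v H' γH δ = -1) :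
    classOrbitalIntegral mG ((cmLocalIntegralLevel L 3 H' v : Set ((cmDatum L 3 H').Local v)).indicator fun _ => (1 : ℂ)) (ConjClasses.mk δ) =
      ((Flicker1998.phiTHprimen (Ideal.absNorm v.asIdeal) n N : ℚ) : ℂ) := by
  haveI : IsAdicComplete (IsLocalRing.maximalIdeal (Valued.integer (w.1.adicCompletion L))) (Valued.integer (w.1.adicCompletion L)) :=
    isAdicComplete_maximalIdeal_valuedInteger_adicCompletion L w.1
  exact classOrbitalIntegral_indicator_eq_phiTHprimen_of_finKappaAt_eq_neg_one L H' hH' hH'u w hw hv hH'w hH'i νG hmG hνG h2 hreg hint n N hn hN δ h hκ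

end Literature.NumberTheory.Rogawski1990

end
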